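import Summits.BirchSwinnertonDyer.BirchSwinnertonDyer.Theorems.AlignedTransportAtTwoMainConjectureOfRankZeroBSDAtTwoCubicTowerGrowth
import Summits.BirchSwinnertonDyer.BirchSwinnertonDyer.Theorems.AlignedTransportAtTwoMainConjectureOfRankZeroBSDAtTwoZpTowerMonotone
import Literature.NumberTheory.EllipticCurves.ZpExtensionRestrictTwoSqrtTwo
import Literature.NumberTheory.IwasawaTheory.CyclotomicTwoTotallyRamifiedNoSqrtTwo
import Mathlib.NumberTheory.NumberField.Units.DirichletTheorem
import HarnessLib

/-!
# Route `AlignedTransportAtTwo`, crux C2 `MainConjectureOfRankZeroBSDAtTwo` (stmt-BirchSwinnertonDyer-22298):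
# CHEVALLEY GROWTH FOR ANY UNIT RANK — `e_0 + s·n ≤ e_n + n + n·u + log₂ #μ(K)` along the cyclotomic `ℤ₂`-tower of ANY number field with `√2 ∈ K₁`
# and `s` places above `2` of odd index; `s ≥ u + 2` ⟹ the `2`-class number jumps at every layer, `μ = 0 ⟹ λ ≥ s − 1 − u`

HONEST FRAMING (cell `bsd-f1-sign2`, WIDTH-5 attached prover seat `bsd-line-att-p3` gen 25, line `birth`, lead `bsd-line-att-p2`; `--supports`
stmt-BirchSwinnertonDyer-22298, closes nothing; BSD is NOT proved; crux C2, its verdict «blocked-on `Rank1Residual.GreenbergMuConjectureIrreducible`» and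
every registered stub untouched). THEOREMS ONLY — no definition, no named fact, no `sorry`. Sixth file of this seat's «Chevalley along the whole tower»:
the unit-rank-`1` / odd-degree hypotheses of `…CubicTowerGrowth` are removed, so the SAME count covers the three fields of a Kilford seed `W`
(`Δ_W ≡ 1 (mod 8)`, `Δ_W < 0`): the cubic `ℚ(e₁)` (`s = 3`, `u = 1`), the resolvent quadratic `ℚ(√Δ_W)` (`2` split: `s = 2`, `u = 0`, the classical
`λ₂ ≥ 1`), and the `S₃`-sextic `ℚ(W[2])` = carrier of the lead's SEXTIC CRITERION (v9) and of NECESSITY (p607593) (`s = 6`, `u = 2`: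
`e_n ≥ e_0 + 3n − log₂ #μ`, so class-NUMBER stabilisation certificates for `μ₂(ℚ(W[2])) = 0` are void there too).
* §8 (any `p`, cyclic `L/K` of degree `pⁿ`): `exists_relIndex_map_pow_eq_pow` (`[E_K : E_K^{pⁿ}] = p^k`, `k ≤ n·u + log_p #μ(K)`; Dirichlet, Mathlib
  `NumberField.Units.exist_unique_eq_mul_prod`); **`padicValNat_classNumber_add_le_of_rank`** (`p^{mn} ∣ ∏ e_𝔭 ⟹ ord_p h_K + m·n ≤ ord_p h_L + n + n·u + log_p #μ`).
* §9 (`p = 2`, any `K` with `√2 ∈ K₁`, all places above `2` of odd index): `ramificationIdxIn_layer_eq_pow_of_sq_eq_two`,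
  **`classNumberPExp_zero_add_le_layer_of_rank`** (`e_0 + m·n ≤ e_n + n + n·u + log₂ #μ`); for `s ≥ u + 2` such places **`classNumberPExp_succ_ne_of_rank`**,
  **`classNumberPExp_lt_succ_of_rank`** (`e_n < e_{n+1}` ∀ n, with `…ZpTowerMonotone`), **`le_slope_of_linear_growth_of_rank`** (`μ = 0 ⟹ λ ≥ s − 1 − u`);
  `θ`-free forms `…_of_not_four_dvd` (`4 ∤ [K:ℚ]`, `κ` cyclotomic; tree `exists_sq_eq_two_layer_one_of_forall_sq_ne_two`, cell bsd-wall).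
References: [Lang1990] Ch. 13 §4, L4.1–4.2; [Washington1997] §13.1, Prop. 4.11, Thm. 13.13; [Fukuda1994] Thm. 1 (1); [NeukirchANT1999] Ch. I §7 (7.4).
-/

set_option linter.dupNamespace false
set_option autoImplicit false

noncomputable section
open scoped Classical NumberField nonZeroDivisors
namespace Summit.BirchSwinnertonDyer.BirchSwinnertonDyer.Theorems.AlignedTransportAtTwoZpTowerChevalleyGrowth

open NumberField IsDedekindDomain
open Literature.NumberTheory.NumberFields Literature.NumberTheory.NumberFields.AmbiguousClass
  Literature.NumberTheory.NumberFields.AmbiguousIdeal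
  Literature.NumberTheory.GaloisRepresentations
  Literature.NumberTheory.GaloisRepresentations.Herbrand Literature.NumberTheory.GaloisRepresentations.MinkowskiUnit
  Literature.NumberTheory.GaloisRepresentations.CyclicNormIndex Literature.NumberTheory.IwasawaTheory
  Literature.NumberTheory.EllipticCurves
  Summit.BirchSwinnertonDyer.BirchSwinnertonDyer.Theorems.AlignedTransportAtTwoCubicLayerOneParity
  Summit.BirchSwinnertonDyer.BirchSwinnertonDyer.Theorems.AlignedTransportAtTwoCubicTowerGrowth
  Summit.BirchSwinnertonDyer.BirchSwinnertonDyer.Theorems.AlignedTransportAtTwoZpTowerMonotone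

/-! ## §8 GENERAL UNIT RANK: `[E_K : E_K^{pⁿ}] ≤ #μ(K) · p^{n·u}`, Chevalley at a cyclic layer of degree `pⁿ` (any `p`),
and the `2`-tower for ANY base field with `√2 ∈ K₁`: `e_0 + s·n ≤ e_n + n + n·u + log₂ #μ(K)` -/

section GeneralRank
variable {K L : Type} [Field K] [NumberField K] [Field L] [NumberField L] [Algebra K L] {p : ℕ} [hp : Fact p.Prime]

omit [NumberField L] in
open NumberField.Units in
/-- **`[E_K : E_K^{pⁿ}] = p^k` with `k ≤ n·u + log_p #μ(K)`** (`u` the unit rank, `μ(K)` the roots of unity): by Dirichlet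
(Mathlib `NumberField.Units.exist_unique_eq_mul_prod`) `E_K / E_K^{pⁿ}` is the image of `μ(K) × (ℤ/pⁿ)^u`, and it has exponent dividing `pⁿ`.
[cite: NeukirchANT1999, Ch. I §7, Thm. (7.4)] [cite: Lang1990, Ch. 13 §4, proof of Lemma 4.2] -/
theorem exists_relIndex_map_pow_eq_pow (n : ℕ) :
    ∃ k : ℕ, ((unitsE L ⊓ (unitsIncl K L).range).map (powMonoidHom (p ^ n))).relIndex (unitsE L ⊓ (unitsIncl K L).range) = p ^ k ∧
      k ≤ n * Units.rank K + Nat.log p (torsionOrder K) := by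
  classical
  set B := unitsE L ⊓ (unitsIncl K L).range with hB
  set A := B.map (powMonoidHom (p ^ n)) with hA
  set H : Subgroup B := A.subgroupOf B with hH
  have hidx : A.relIndex B = Nat.card (B ⧸ H) := rfl
  have hpow : ∀ b : B, ((b : Lˣ) ^ (p ^ n)) ∈ A := fun b => ⟨b, b.2, rfl⟩
  set ι : (𝓞 K)ˣ →* Lˣ := (unitsIncl K L).comp (Units.map (algebraMap (𝓞 K) K : 𝓞 K →* K)) with hι
  have hιmem : ∀ v : (𝓞 K)ˣ, ι v ∈ B := fun v => unitsIncl_map_mem v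
  have hp1 : 1 < p := hp.out.one_lt
  have hN0 : (0 : ℤ) < (p : ℤ) ^ n := by positivity
  set N : ℤ := (p : ℤ) ^ n with hN
  -- the surjection `μ(K) × (Fin u → Fin pⁿ) → B ⧸ H`
  let φ : torsion K × (Fin (Units.rank K) → Fin (p ^ n)) → B ⧸ H := fun c =>
    QuotientGroup.mk ⟨ι ((c.1 : (𝓞 K)ˣ) * ∏ i, fundSystem K i ^ (c.2 i : ℕ)), hιmem _⟩
  have hφ : Function.Surjective φ := by
    intro q
    obtain ⟨y, rfl⟩ := QuotientGroup.mk_surjective q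
    obtain ⟨v, hv⟩ := exists_ringOfIntegers_unit_of_mem (K := K) (L := L) y.2
    have hv' : ι v = (y : Lˣ) := hv
    obtain ⟨⟨ζ, e⟩, hx, -⟩ := exist_unique_eq_mul_prod K v
    change v = (ζ : (𝓞 K)ˣ) * ∏ i, fundSystem K i ^ e i at hx
    have hr : ∀ i, 0 ≤ e i % N ∧ e i % N < N := fun i => ⟨Int.emod_nonneg _ hN0.ne', Int.emod_lt_of_pos _ hN0⟩
    let r : Fin (Units.rank K) → Fin (p ^ n) := fun i => ⟨(e i % N).toNat, by
      have h1 : ((e i % N).toNat : ℤ) < (p : ℤ) ^ n := by rw [Int.toNat_of_nonneg (hr i).1]; exact (hr i).2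
      exact_mod_cast h1⟩
    have hrcast : ∀ i, ((r i : ℕ) : ℤ) = e i % N := fun i => Int.toNat_of_nonneg (hr i).1
    -- `∏ f_i^{e_i} = (∏ f_i^{e_i / N})^{pⁿ} · ∏ f_i^{r_i}`
    set Q : (𝓞 K)ˣ := ∏ i, fundSystem K i ^ (e i / N) with hQ
    set R : (𝓞 K)ˣ := ∏ i, fundSystem K i ^ (r i : ℕ) with hR
    have hE : (∏ i, fundSystem K i ^ e i) = Q ^ (p ^ n) * R := by
      rw [hQ, hR, ← Finset.prod_pow, ← Finset.prod_mul_distrib]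
      refine Finset.prod_congr rfl fun i _ => ?_
      rw [← zpow_natCast (fundSystem K i ^ (e i / N)) (p ^ n), ← zpow_mul, ← zpow_natCast (fundSystem K i) (r i : ℕ), ← zpow_add,
        hrcast i]
      congr 1
      push_cast
      rw [hN]
      exact (Int.mul_ediv_add_emod (e i) ((p : ℤ) ^ n)).symm.trans (by ring)
    refine ⟨(ζ, r), ?_⟩
    change QuotientGroup.mk (⟨ι ((ζ : (𝓞 K)ˣ) * R), hιmem _⟩ : B) = QuotientGroup.mk y
    rw [QuotientGroup.eq, hH, Subgroup.mem_subgroupOf]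
    have hcalc : (((⟨ι ((ζ : (𝓞 K)ˣ) * R), hιmem _⟩ : B)⁻¹ * y : B) : Lˣ) = ((⟨ι Q, hιmem Q⟩ : B) : Lˣ) ^ (p ^ n) := by
      change (ι ((ζ : (𝓞 K)ˣ) * R))⁻¹ * (y : Lˣ) = (ι Q) ^ (p ^ n)
      rw [← hv', hx, hE, ← map_inv, ← map_mul, ← map_pow]
      congr 1
      rw [mul_comm (Q ^ (p ^ n)) R, ← mul_assoc (ζ : (𝓞 K)ˣ) R (Q ^ (p ^ n)), inv_mul_cancel_left]
    rw [hcalc]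
    exact hpow ⟨ι Q, hιmem Q⟩
  haveI : Finite (B ⧸ H) := Finite.of_surjective φ hφ
  have hle : Nat.card (B ⧸ H) ≤ torsionOrder K * (p ^ n) ^ Units.rank K := by
    have h := Nat.card_le_card_of_surjective φ hφ
    rwa [Nat.card_prod, Nat.card_fun, Nat.card_eq_fintype_card (α := Fin (p ^ n)), Fintype.card_fin,
      Nat.card_eq_fintype_card (α := Fin (Units.rank K)), Fintype.card_fin] at h
  -- `B ⧸ H` is a `p`-group
  have hP : IsPGroup p (B ⧸ H) := by
    intro x
    obtain ⟨y, rfl⟩ := QuotientGroup.mk_surjective x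
    refine ⟨n, ?_⟩
    rw [← QuotientGroup.mk_pow, QuotientGroup.eq_one_iff, hH, Subgroup.mem_subgroupOf, Subgroup.coe_pow]
    exact hpow y
  obtain ⟨k, hk⟩ := IsPGroup.iff_card.mp hP
  refine ⟨k, by rw [hidx, hk], ?_⟩
  rw [hk, ← pow_mul, mul_comm] at hle
  -- `p^k ≤ T · p^{n u}` forces `k ≤ n u + log_p T`
  by_contra hlt
  have hk' : n * Units.rank K + Nat.log p (torsionOrder K) + 1 ≤ k := by omega
  have hT : torsionOrder K < p ^ (Nat.log p (torsionOrder K) + 1) := Nat.lt_pow_succ_log_self hp1 _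
  have : p ^ k ≥ p ^ (n * Units.rank K) * p ^ (Nat.log p (torsionOrder K) + 1) := by
    rw [← pow_add]; exact Nat.pow_le_pow_right hp.out.pos hk'
  have hpos : 0 < p ^ (n * Units.rank K) := pow_pos hp.out.pos _
  nlinarith

/-- **Chevalley at a cyclic layer of degree `pⁿ`, downward, any unit rank.** `L/K` cyclic of degree `pⁿ`, `2^{mn}`—more generally `p^{mn} ∣ ∏_𝔭 e_𝔭(L/K)`
(e.g. `m` primes of `K` with index `pⁿ` in `L`): **`ord_p h_K + m·n ≤ ord_p h_L + n + n·u + log_p #μ(K)`** (`u` the unit rank of `K`). Lang's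
Lemma 4.1–4.2 (tree `AmbiguousClass.dvd_card_fixed_mul`) with `#Cl(L)^G ∣ h_L` and `exists_relIndex_map_pow_eq_pow`.
[cite: Lang1990, Ch. 13 §4, Lemma 4.1–4.2 (PDF pp. 203–204)] [cite: Gras2003, II.6.2.3] -/
theorem padicValNat_classNumber_add_le_of_rank [IsGalois K L] [IsCyclic (L ≃ₐ[K] L)] {n m : ℕ} (hdeg : Module.finrank K L = p ^ n)
    (hm : p ^ (m * n) ∣ ∏ᶠ v : HeightOneSpectrum (𝓞 K), v.asIdeal.ramificationIdxIn (𝓞 L)) :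
    padicValNat p (classNumber K) + m * n ≤
      padicValNat p (classNumber L) + (n + n * Units.rank K + Nat.log p (NumberField.Units.torsionOrder K)) := by
  haveI : FiniteDimensional K L := Module.Finite.of_restrictScalars_finite ℚ K L
  have hp0 : p ≠ 0 := hp.out.ne_zero
  obtain ⟨σ, hσ⟩ := IsCyclic.exists_generator (α := L ≃ₐ[K] L)
  have h := dvd_card_fixed_mul hσ
  rw [hdeg] at h
  set F := Nat.card {c : ClassGroup (𝓞 L) // ∀ τ : L ≃ₐ[K] L, ClassGroup.mulEquiv (intAut τ) c = c} with hF
  have hFdvd : F ∣ classNumber L := card_fixed_dvd_classNumber (K := K) (L := L)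
  obtain ⟨k, hk, hkle⟩ := exists_relIndex_map_pow_eq_pow (K := K) (L := L) (p := p) n
  have hI : ((unitsE L ⊓ (unitsIncl K L).range).map (powMonoidHom (p ^ n))).relIndex (unitsE L ⊓ (unitsIncl K L).range) ∣
      p ^ (n * Units.rank K + Nat.log p (NumberField.Units.torsionOrder K)) := by
    rw [hk]; exact pow_dvd_pow p hkle
  have ha : p ^ padicValNat p (classNumber K) ∣ classNumber K := pow_padicValNat_dvd
  have h1 : p ^ (padicValNat p (classNumber K) + m * n) ∣
      classNumber L * p ^ (n + n * Units.rank K + Nat.log p (NumberField.Units.torsionOrder K)) := by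
    have step1 : p ^ (padicValNat p (classNumber K) + m * n) ∣
        classNumber K * (∏ᶠ v : HeightOneSpectrum (𝓞 K), v.asIdeal.ramificationIdxIn (𝓞 L)) * ArchHerbrand.archFactor K L := by
      rw [pow_add]
      exact (mul_dvd_mul ha hm).trans (dvd_mul_right _ _)
    have step2 : F * p ^ n *
        ((unitsE L ⊓ (unitsIncl K L).range).map (powMonoidHom (p ^ n))).relIndex (unitsE L ⊓ (unitsIncl K L).range) ∣
        classNumber L * p ^ (n + n * Units.rank K + Nat.log p (NumberField.Units.torsionOrder K)) := by
      have : classNumber L * p ^ (n + n * Units.rank K + Nat.log p (NumberField.Units.torsionOrder K)) =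
          classNumber L * p ^ n * p ^ (n * Units.rank K + Nat.log p (NumberField.Units.torsionOrder K)) := by ring
      rw [this]
      exact mul_dvd_mul (mul_dvd_mul_right hFdvd _) hI
    exact step1.trans (h.trans step2)
  have hne : classNumber L * p ^ (n + n * Units.rank K + Nat.log p (NumberField.Units.torsionOrder K)) ≠ 0 :=
    mul_ne_zero (classNumber_ne_zero L) (pow_ne_zero _ hp0)
  have h2 := (padicValNat_dvd_iff_le hne).mp h1
  rwa [padicValNat.mul (classNumber_ne_zero L) (pow_ne_zero _ hp0), padicValNat.prime_pow] at h2

end GeneralRank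

/-! ## §9 The `2`-tower over ANY base field whose first layer contains `√2` -/
section GeneralTower
variable {K : Type} [Field K] [NumberField K]

/-- **Odd `e(w ∣ 2)` and `√2 ∈ K₁` ⟹ `w` ramifies in `K₁`** (any base field). [cite: Washington1997, §13.1] [cite: NeukirchANT1999, Ch. I §8] -/
theorem not_isUnramifiedIn_layer_one_of_sq_eq_two (κ : ZpExtension K 2) {θ : κ.layer 1} (hθ : θ ^ 2 = 2)
    {w : HeightOneSpectrum (𝓞 K)} (hw : ((2 : ℕ) : 𝓞 K) ∈ w.asIdeal) (hodd : Odd (w.asIdeal.ramificationIdx ℤ)) :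
    ¬ Algebra.IsUnramifiedIn (𝓞 (κ.layer 1)) w.asIdeal := by
  haveI : FiniteDimensional K (κ.layer 1) := κ.finiteDimensional_layer_holds 1
  haveI : NumberField (κ.layer 1) := NumberField.of_module_finite K _
  intro hunr
  haveI : w.asIdeal.IsPrime := w.isPrime
  haveI := liesOver_span_two_of_mem w hw
  obtain ⟨⟨Q, hQprime, hQover⟩⟩ := (inferInstance : Nonempty (Ideal.primesOver w.asIdeal (𝓞 (κ.layer 1))))
  haveI := hQprime
  haveI := hQover
  haveI : Q.LiesOver (Ideal.span {(2 : ℤ)}) := Ideal.LiesOver.trans Q w.asIdeal _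
  have h1 : Q.ramificationIdx (𝓞 K) = 1 := hunr.ramificationIdx_eq_one hQover
  have heven := even_ramificationIdx_int_of_sq_eq_two hθ Q
  rw [Ideal.ramificationIdx_tower w.asIdeal Q, h1, mul_one] at heven
  exact (Nat.not_even_iff_odd.mpr hodd) heven

/-- **Total ramification at EVERY layer, any base field**: `√2 ∈ K₁`, all places above `2` of odd absolute index ⟹ `e(w, K_n/K) = 2ⁿ` for every
`w ∣ 2`, `n ≥ 1` (as `ramificationIdxIn_layer_eq_pow`, with the odd-degree hypothesis replaced by `√2 ∈ K₁`). [cite: Washington1997, §13.1 Lemma 13.3]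
[cite: NeukirchANT1999, Ch. I §9 Prop. (9.6)] -/
theorem ramificationIdxIn_layer_eq_pow_of_sq_eq_two (κ : ZpExtension K 2) {θ₁ : κ.layer 1} (hθ₁ : θ₁ ^ 2 = 2)
    (hodd : ∀ w : HeightOneSpectrum (𝓞 K), ((2 : ℕ) : 𝓞 K) ∈ w.asIdeal → Odd (w.asIdeal.ramificationIdx ℤ))
    {w : HeightOneSpectrum (𝓞 K)} (hw : ((2 : ℕ) : 𝓞 K) ∈ w.asIdeal) {n : ℕ} (hn : 1 ≤ n) :
    haveI : FiniteDimensional K (κ.layer n) := κ.finiteDimensional_layer_holds n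
    w.asIdeal.ramificationIdxIn (𝓞 (κ.layer n)) = 2 ^ n := by
  haveI : FiniteDimensional K (κ.layer n) := κ.finiteDimensional_layer_holds n
  haveI : IsGalois K (κ.layer n) := κ.isGalois_layer_holds n
  haveI : NumberField (κ.layer n) := NumberField.of_module_finite K _
  have hram : TotallyRamifiedFrom κ 0 :=
    totallyRamifiedFrom_zero_of_forall_not_isUnramifiedIn_layer_one κ fun w hw =>
      not_isUnramifiedIn_layer_one_of_sq_eq_two κ hθ₁ hw (hodd w hw)
  have hle : κ.layer 1 ≤ κ.layer n := κ.layer_mono hn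
  set θ : κ.layer n := ⟨(θ₁ : AlgebraicClosure K), hle θ₁.2⟩ with hθdef
  have h1 : (algebraMap (κ.layer 1) (AlgebraicClosure K) θ₁) ^ 2 = 2 := by rw [← map_pow, hθ₁, map_ofNat]
  have hθ : θ ^ 2 = 2 := by
    apply (algebraMap (κ.layer n) (AlgebraicClosure K)).injective
    rw [map_pow, map_ofNat]
    exact h1
  haveI : w.asIdeal.IsPrime := w.isPrime
  haveI := liesOver_span_two_of_mem w hw
  obtain ⟨⟨Q, hQprime, hQover⟩⟩ :=
    (inferInstance : Nonempty (Ideal.primesOver w.asIdeal (𝓞 (κ.layer n))))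
  haveI := hQprime
  haveI := hQover
  haveI : Q.LiesOver (Ideal.span {(2 : ℤ)}) := Ideal.LiesOver.trans Q w.asIdeal _
  have heven := even_ramificationIdx_int_of_sq_eq_two hθ Q
  rw [Ideal.ramificationIdx_tower w.asIdeal Q] at heven
  have hne1 : Q.ramificationIdx (𝓞 K) ≠ 1 := by
    intro h1'
    rw [h1', mul_one] at heven
    exact (Nat.not_even_iff_odd.mpr (hodd w hw)) heven
  have hQ0 : Q ≠ ⊥ := Ideal.ne_bot_of_liesOver_of_ne_bot w.ne_bot Q
  haveI hQmax : Q.IsMaximal := hQprime.isMaximal hQ0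
  haveI : Module.Finite (𝓞 K) (𝓞 (κ.layer n)) := IsIntegralClosure.finite (𝓞 K) K (κ.layer n) (𝓞 (κ.layer n))
  haveI : IsGaloisGroup ((κ.layer n) ≃ₐ[K] (κ.layer n)) (𝓞 K) (𝓞 (κ.layer n)) :=
    IsGaloisGroup.of_isFractionRing _ (𝓞 K) (𝓞 (κ.layer n)) K (κ.layer n)
  have hcard := Ideal.card_inertia_eq_ramificationIdxIn (G := (κ.layer n) ≃ₐ[K] (κ.layer n)) w.asIdeal Q
  have hidx := Ideal.ramificationIdxIn_eq_ramificationIdx w.asIdeal Q ((κ.layer n) ≃ₐ[K] (κ.layer n))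
  rcases κ.inertia_layer_eq_bot_or_forall_mem hram le_rfl (Nat.zero_le n) Q with h0 | hall
  · exfalso
    rw [h0, Subgroup.card_bot] at hcard
    exact hne1 (by rw [← hidx, ← hcard])
  · have htop : Q.inertia ((κ.layer n) ≃ₐ[K] (κ.layer n)) = ⊤ := by
      rw [eq_top_iff]
      intro g _
      refine hall g fun x hx => ?_
      rw [κ.layer_zero] at hx
      obtain ⟨c, hc⟩ := IntermediateField.mem_bot.mp hx
      have hxc : x = algebraMap K (κ.layer n) c := Subtype.ext hc.symm
      rw [hxc, AlgEquiv.commutes]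
    rw [htop, Subgroup.card_top, IsGalois.card_aut_eq_finrank, κ.finrank_layer_holds n] at hcard
    exact hcard.symm

/-- `2^{mn} ∣ ∏_𝔭 e_𝔭(K_n/K)` for `m ≤ #{w ∣ 2}`, any base field with `√2 ∈ K₁` and odd indices above `2`. [cite: Washington1997, §13.1] -/
theorem pow_dvd_finprod_ramificationIdxIn_layer_of_sq_eq_two (κ : ZpExtension K 2) {θ₁ : κ.layer 1} (hθ₁ : θ₁ ^ 2 = 2)
    (hodd : ∀ w : HeightOneSpectrum (𝓞 K), ((2 : ℕ) : 𝓞 K) ∈ w.asIdeal → Odd (w.asIdeal.ramificationIdx ℤ))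
    {m : ℕ} (hm : m ≤ {w : HeightOneSpectrum (𝓞 K) | ((2 : ℕ) : 𝓞 K) ∈ w.asIdeal}.ncard) {n : ℕ} (hn : 1 ≤ n) :
    haveI : FiniteDimensional K (κ.layer n) := κ.finiteDimensional_layer_holds n
    2 ^ (m * n) ∣ ∏ᶠ v : HeightOneSpectrum (𝓞 K), v.asIdeal.ramificationIdxIn (𝓞 (κ.layer n)) := by
  classical
  haveI : FiniteDimensional K (κ.layer n) := κ.finiteDimensional_layer_holds n
  haveI : IsGalois K (κ.layer n) := κ.isGalois_layer_holds n
  haveI : NumberField (κ.layer n) := NumberField.of_module_finite K _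
  set f : HeightOneSpectrum (𝓞 K) → ℕ := fun v => v.asIdeal.ramificationIdxIn (𝓞 (κ.layer n)) with hf
  set S := {w : HeightOneSpectrum (𝓞 K) | ((2 : ℕ) : 𝓞 K) ∈ w.asIdeal} with hS
  have hfS : ∀ w ∈ S, f w = 2 ^ n := fun w hw => ramificationIdxIn_layer_eq_pow_of_sq_eq_two κ hθ₁ hodd hw hn
  have h2n : (2 : ℕ) ^ n ≠ 1 := by
    have : 2 ≤ 2 ^ n := by
      calc (2 : ℕ) = 2 ^ 1 := by norm_num
        _ ≤ 2 ^ n := Nat.pow_le_pow_right (by norm_num) hn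
    omega
  have hT := finite_setOf_ramificationIdxIn_ne_one (K := K) (L := κ.layer n)
  have hST : S ⊆ {v : HeightOneSpectrum (𝓞 K) | v.asIdeal.ramificationIdxIn (𝓞 (κ.layer n)) ≠ 1} := fun w hw => by
    change f w ≠ 1
    rw [hfS w hw]; exact h2n
  have hSfin : S.Finite := hT.subset hST
  have hsupp : Function.mulSupport f ⊆ ↑hT.toFinset := fun v hv => by
    rw [Set.Finite.coe_toFinset]; exact hv
  rw [finprod_eq_prod_of_mulSupport_subset f hsupp]
  have hsub : hSfin.toFinset ⊆ hT.toFinset := by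
    intro v hv
    rw [Set.Finite.mem_toFinset] at hv ⊢
    exact hST hv
  have hprodS : ∏ v ∈ hSfin.toFinset, f v = 2 ^ (n * S.ncard) := by
    rw [Finset.prod_congr rfl (fun v hv => hfS v ((Set.Finite.mem_toFinset hSfin).mp hv)), Finset.prod_const,
      ← Set.ncard_eq_toFinset_card S hSfin, ← pow_mul]
  have hdvd : ∏ v ∈ hSfin.toFinset, f v ∣ ∏ v ∈ hT.toFinset, f v := Finset.prod_dvd_prod_of_subset _ _ _ hsub
  rw [hprodS] at hdvd
  refine (pow_dvd_pow 2 ?_).trans hdvd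
  rw [mul_comm]
  exact Nat.mul_le_mul_left n hm

/-- **`e_0 + m·n ≤ e_n + n + n·u + log₂ #μ(K)` along the cyclotomic `ℤ₂`-tower of ANY base field with `√2 ∈ K₁`** (e.g. `4 ∤ [K:ℚ]`, `√2 ∉ K`), all
places above `2` of odd index, `m ≤ #{w ∣ 2}`, `u` the unit rank. INSTANCES: complex cubic with `2` totally split (`m = 3`, `u = 1`, `#μ = 2`:
`e_n ≥ e_0 + n − 1`, this seat's FILE A); imaginary quadratic with `2` split (`m = 2`, `u = 0`: `e_n ≥ e_0 + n − 1`, the classical `λ₂ ≥ 1`); the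
`S₃`-SEXTIC `ℚ(W[2])` of a Kilford seed (`m = 6`, `u = 2`: `e_n ≥ e_0 + 3n − log₂ #μ`). [cite: Lang1990, Ch. 13 §4, Lemma 4.1–4.2]
[cite: Washington1997, §13.1] [cite: Fukuda1994, p. 264 (notation `e_n`)] -/
theorem classNumberPExp_zero_add_le_layer_of_rank (κ : ZpExtension K 2) {θ₁ : κ.layer 1} (hθ₁ : θ₁ ^ 2 = 2)
    (hodd : ∀ w : HeightOneSpectrum (𝓞 K), ((2 : ℕ) : 𝓞 K) ∈ w.asIdeal → Odd (w.asIdeal.ramificationIdx ℤ))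
    {m : ℕ} (hm : m ≤ {w : HeightOneSpectrum (𝓞 K) | ((2 : ℕ) : 𝓞 K) ∈ w.asIdeal}.ncard) (n : ℕ) :
    classNumberPExp κ 0 + m * n ≤
      classNumberPExp κ n + (n + n * Units.rank K + Nat.log 2 (NumberField.Units.torsionOrder K)) := by
  haveI : Fact (Nat.Prime 2) := ⟨Nat.prime_two⟩
  rcases Nat.eq_zero_or_pos n with rfl | hn
  · simp
  haveI : FiniteDimensional K (κ.layer n) := κ.finiteDimensional_layer_holds n
  haveI : IsGalois K (κ.layer n) := κ.isGalois_layer_holds n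
  haveI : NumberField (κ.layer n) := NumberField.of_module_finite K _
  haveI : IsCyclic ((κ.layer n) ≃ₐ[K] (κ.layer n)) := isCyclic_aut_layer κ n
  have hdeg : Module.finrank K (κ.layer n) = 2 ^ n := κ.finrank_layer_holds n
  have h := padicValNat_classNumber_add_le_of_rank (K := K) (L := κ.layer n) (p := 2) hdeg
    (pow_dvd_finprod_ramificationIdxIn_layer_of_sq_eq_two κ hθ₁ hodd hm hn)
  rw [classNumberPExp_zero_eq_padicValNat_classNumber, classNumberPExp_eq_padicValNat_classNumber]
  exact h

/-- **THE JUMP, general form: `s ≥ u + 2` odd-index places above `2` ⟹ `e_{n+1} ≠ e_n` for every `n`** (Fukuda's Thm. 1 (1) at index `0` against the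
unbounded growth `e_n ≥ e_0 + (s − 1 − u)·n − log₂ #μ(K)`). [cite: Fukuda1994, Thm. 1 (1), p. 264] [cite: Lang1990, Ch. 13 §4, Lemma 4.1–4.2] -/
theorem classNumberPExp_succ_ne_of_rank (κ : ZpExtension K 2) {θ₁ : κ.layer 1} (hθ₁ : θ₁ ^ 2 = 2)
    (hodd : ∀ w : HeightOneSpectrum (𝓞 K), ((2 : ℕ) : 𝓞 K) ∈ w.asIdeal → Odd (w.asIdeal.ramificationIdx ℤ))
    {s : ℕ} (hs : s ≤ {w : HeightOneSpectrum (𝓞 K) | ((2 : ℕ) : 𝓞 K) ∈ w.asIdeal}.ncard) (hsu : Units.rank K + 2 ≤ s) (n : ℕ) :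
    classNumberPExp κ (n + 1) ≠ classNumberPExp κ n := by
  intro he
  have hram : TotallyRamifiedFrom κ 0 :=
    totallyRamifiedFrom_zero_of_forall_not_isUnramifiedIn_layer_one κ fun w hw =>
      not_isUnramifiedIn_layer_one_of_sq_eq_two κ hθ₁ hw (hodd w hw)
  set c := Nat.log 2 (NumberField.Units.torsionOrder K) with hc
  set M := n + classNumberPExp κ n + c + 1 with hM
  have hconst := fukuda1994_thm1_classNumberPExp_const_of_succ_eq_holds K 2 κ 0 hram n (Nat.zero_le n) he M (by omega)
  have hgrow := classNumberPExp_zero_add_le_layer_of_rank κ hθ₁ hodd hs M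
  have hsM : (Units.rank K + 2) * M ≤ s * M := Nat.mul_le_mul_right M hsu
  have hexp : (Units.rank K + 2) * M = M * Units.rank K + 2 * M := by ring
  omega

/-- **STRICT growth, general form: `e_n < e_{n+1}`** (monotonicity above the Fukuda index `0`, FILE D, + the jump). [cite: Fukuda1994, Thm. 1 (1)]
[cite: Washington1997, Prop. 4.11] -/
theorem classNumberPExp_lt_succ_of_rank (κ : ZpExtension K 2) {θ₁ : κ.layer 1} (hθ₁ : θ₁ ^ 2 = 2)
    (hodd : ∀ w : HeightOneSpectrum (𝓞 K), ((2 : ℕ) : 𝓞 K) ∈ w.asIdeal → Odd (w.asIdeal.ramificationIdx ℤ))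
    {s : ℕ} (hs : s ≤ {w : HeightOneSpectrum (𝓞 K) | ((2 : ℕ) : 𝓞 K) ∈ w.asIdeal}.ncard) (hsu : Units.rank K + 2 ≤ s) (n : ℕ) :
    classNumberPExp κ n < classNumberPExp κ (n + 1) := by
  have hram : TotallyRamifiedFrom κ 0 :=
    totallyRamifiedFrom_zero_of_forall_not_isUnramifiedIn_layer_one κ fun w hw =>
      not_isUnramifiedIn_layer_one_of_sq_eq_two κ hθ₁ hw (hodd w hw)
  have h1 := classNumberPExp_le_succ_of_totallyRamifiedFrom κ hram (Nat.zero_le n)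
  have h2 := classNumberPExp_succ_ne_of_rank κ hθ₁ hodd hs hsu n
  omega

/-- **`μ = 0 ⟹ λ ≥ s − 1 − u`**: any eventual law `e_n = l·n + ν` has `s ≤ l + 1 + u` (cubic Kilford fields: `λ₂ ≥ 1`; their resolvent quadratic
fields `ℚ(√Δ_W)`: `λ₂ ≥ 1`; their `S₃`-sextics `ℚ(W[2])`: `λ₂ ≥ 3`). [cite: Lang1990, Ch. 5 §1 Thm. 1.2 and Ch. 13 §4] [cite: Washington1997, §13.3 Thm. 13.13] -/
theorem le_slope_of_linear_growth_of_rank (κ : ZpExtension K 2) {θ₁ : κ.layer 1} (hθ₁ : θ₁ ^ 2 = 2)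
    (hodd : ∀ w : HeightOneSpectrum (𝓞 K), ((2 : ℕ) : 𝓞 K) ∈ w.asIdeal → Odd (w.asIdeal.ramificationIdx ℤ))
    {s : ℕ} (hs : s ≤ {w : HeightOneSpectrum (𝓞 K) | ((2 : ℕ) : 𝓞 K) ∈ w.asIdeal}.ncard)
    {l : ℕ} {ν : ℤ} {n₀ : ℕ} (hlin : ∀ n, n₀ ≤ n → (classNumberPExp κ n : ℤ) = l * n + ν) : s ≤ l + 1 + Units.rank K := by
  by_contra hlt
  have hsu : l + Units.rank K + 2 ≤ s := by omega
  set c := Nat.log 2 (NumberField.Units.torsionOrder K) with hc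
  set N : ℕ := n₀ + ν.toNat + c + 1 with hN
  have h1 := hlin N (by omega)
  have hgrow := classNumberPExp_zero_add_le_layer_of_rank κ hθ₁ hodd hs N
  have hsN : (l + Units.rank K + 2) * N ≤ s * N := Nat.mul_le_mul_right N hsu
  have hνle : ν ≤ (ν.toNat : ℤ) := Int.self_le_toNat ν
  -- cast the growth inequality to ℤ and substitute the linear law
  have hgrowZ : ((classNumberPExp κ 0 : ℕ) : ℤ) + (s * N : ℕ) ≤ ((classNumberPExp κ N : ℕ) : ℤ) + ((N + N * Units.rank K + c : ℕ) : ℤ) := by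
    exact_mod_cast hgrow
  rw [h1] at hgrowZ
  have hsNZ : (((l + Units.rank K + 2) * N : ℕ) : ℤ) ≤ ((s * N : ℕ) : ℤ) := by exact_mod_cast hsN
  push_cast at hgrowZ hsNZ
  have hN1 : (n₀ : ℤ) + ν.toNat + c + 1 = (N : ℤ) := by rw [hN]; push_cast; ring
  nlinarith

/-- `θ`-free: `4 ∤ [K:ℚ]`, `κ` cyclotomic, odd indices above `2` ⟹ `e_0 + m·n ≤ e_n + n + n·u + log₂ #μ(K)`. [cite: Lang1990, Ch. 13 §4, Lemma 4.1–4.2] -/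
theorem classNumberPExp_zero_add_le_layer_of_not_four_dvd (h4 : ¬ 4 ∣ Module.finrank ℚ K) (κ : ZpExtension K 2) (hκ : κ.IsCyclotomic)
    (hodd : ∀ w : HeightOneSpectrum (𝓞 K), ((2 : ℕ) : 𝓞 K) ∈ w.asIdeal → Odd (w.asIdeal.ramificationIdx ℤ))
    {m : ℕ} (hm : m ≤ {w : HeightOneSpectrum (𝓞 K) | ((2 : ℕ) : 𝓞 K) ∈ w.asIdeal}.ncard) (n : ℕ) :
    classNumberPExp κ 0 + m * n ≤
      classNumberPExp κ n + (n + n * Units.rank K + Nat.log 2 (NumberField.Units.torsionOrder K)) := by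
  obtain ⟨θ₁, hθ₁⟩ := exists_sq_eq_two_layer_one_of_forall_sq_ne_two h4 (forall_sq_ne_two_of_forall_odd_ramificationIdx hodd) κ hκ
  exact classNumberPExp_zero_add_le_layer_of_rank κ hθ₁ hodd hm n

/-- `θ`-free: `4 ∤ [K:ℚ]`, `κ` cyclotomic, odd indices above `2`, at least `u + 2` places ⟹ `e_n < e_{n+1}` for every `n` (cubic `ℚ(e₁)`, resolvent
`ℚ(√Δ_W)`, sextic `ℚ(W[2])` of a Kilford seed). [cite: Fukuda1994, Thm. 1 (1), p. 264] [cite: Washington1997, Prop. 4.11] -/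
theorem classNumberPExp_lt_succ_of_not_four_dvd (h4 : ¬ 4 ∣ Module.finrank ℚ K) (κ : ZpExtension K 2) (hκ : κ.IsCyclotomic)
    (hodd : ∀ w : HeightOneSpectrum (𝓞 K), ((2 : ℕ) : 𝓞 K) ∈ w.asIdeal → Odd (w.asIdeal.ramificationIdx ℤ))
    {s : ℕ} (hs : s ≤ {w : HeightOneSpectrum (𝓞 K) | ((2 : ℕ) : 𝓞 K) ∈ w.asIdeal}.ncard) (hsu : Units.rank K + 2 ≤ s) (n : ℕ) :
    classNumberPExp κ n < classNumberPExp κ (n + 1) := by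
  obtain ⟨θ₁, hθ₁⟩ := exists_sq_eq_two_layer_one_of_forall_sq_ne_two h4 (forall_sq_ne_two_of_forall_odd_ramificationIdx hodd) κ hκ
  exact classNumberPExp_lt_succ_of_rank κ hθ₁ hodd hs hsu n

/-- `θ`-free: `μ = 0 ⟹ λ ≥ s − 1 − u` (`4 ∤ [K:ℚ]`, `κ` cyclotomic, odd indices, `s` places). [cite: Washington1997, §13.3 Thm. 13.13] -/
theorem le_slope_of_linear_growth_of_not_four_dvd (h4 : ¬ 4 ∣ Module.finrank ℚ K) (κ : ZpExtension K 2) (hκ : κ.IsCyclotomic)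
    (hodd : ∀ w : HeightOneSpectrum (𝓞 K), ((2 : ℕ) : 𝓞 K) ∈ w.asIdeal → Odd (w.asIdeal.ramificationIdx ℤ))
    {s : ℕ} (hs : s ≤ {w : HeightOneSpectrum (𝓞 K) | ((2 : ℕ) : 𝓞 K) ∈ w.asIdeal}.ncard)
    {l : ℕ} {ν : ℤ} {n₀ : ℕ} (hlin : ∀ n, n₀ ≤ n → (classNumberPExp κ n : ℤ) = l * n + ν) : s ≤ l + 1 + Units.rank K := by
  obtain ⟨θ₁, hθ₁⟩ := exists_sq_eq_two_layer_one_of_forall_sq_ne_two h4 (forall_sq_ne_two_of_forall_odd_ramificationIdx hodd) κ hκ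
  exact le_slope_of_linear_growth_of_rank κ hθ₁ hodd hs hlin

end GeneralTower

end Summit.BirchSwinnertonDyer.BirchSwinnertonDyer.Theorems.AlignedTransportAtTwoZpTowerChevalleyGrowth
end
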